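import Summits.Ventures.PercRepro.C041TriDomExcessMethod

/-!
# ROW C-041 — THE SYMMETRISED EXCESS WITH FORCED-RED EDGES (`p_e ∈ {½, 1}`)
(p6, gen 41; P6-TWOEXIT-LEAN.md §53 ADDENDUM 5)

A set `R` of edges is FORCED RED: such an edge is in the red graph for every colouring and never in the blue one.
The red adjacency becomes `RAdjF R st ω` (`redE st ω e ∨ R e`), the blue adjacency is unchanged, and the red pattern
`rsigF`.  For a status whose free edges avoid `R` (`NoFreeForced R st`), the recursion of `C041TriDomExcessRec` holds
verbatim (`esymF_rec`: the status-change lemmas at a free edge `f ∉ R` are the same, the blue side is reused), and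
only the BASE CASE changes: with no free edge the blue graph is contained in the red one, so the blue pattern refines
the red one (`le3_bsig_rsigF_of_nofree`) and the symmetrised functional is non-negative there (`Fsym_nonneg_of_le3`:
it is negative only on the crossed two-block pairs, which are incomparable).  Hence **`esymF_nonneg`**: for every
admissible-by-symmetry functional `Fsym`, `0 ≤ Σ_ω Fsym (rsigF R st ω) (bsig st ω)`, and for the host with the edges
of `R` forced red and the others free (`forcedStatus R`), **`esym_forced_nonneg`**: the symmetric excess
`N(⊤,⊥) + N(⊥,⊤) − Σ_{i ≠ j} N(s_i, s_j)` is non-negative with forced-red edges — the first piece of the `p ≥ ½`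
question.  (With forced edges of BOTH colours the base configuration can be a crossed pair: no theorem, and indeed
g40's numerics fail there.)
-/

namespace PercRepro

namespace ZoneZ

namespace MultiExit

open ZoneData Pendant Finset TwoExit TreeClosure RelaxedTriangle

variable {V₁ E₁ U₁ U₂ : Type} (Z₁ : ZoneData V₁ E₁ U₁ U₂) (u u' a₁ : V₁)

/-! ## Forced-red edges -/

/-- Red adjacency with the edges of `R` forced red. -/
def RAdjF (R : E₁ → Prop) (st : E₁ → EStat) (ω : E₁ → Bool) (x y : V₁) : Prop :=
  ∃ e, Z₁.Joins e x y ∧ (redE st ω e ∨ R e)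

/-- Red connectivity with forced-red edges. -/
def RdF (R : E₁ → Prop) (st : E₁ → EStat) (ω : E₁ → Bool) (k v : V₁) : Prop :=
  v ∈ ZoneData.reach (RAdjF Z₁ R st ω) {k}

/-- Two status/colouring pairs with the same red edges (given `R`) have the same red adjacency. -/
theorem RAdjF_congr (R : E₁ → Prop) {st st' : E₁ → EStat} {ω ω' : E₁ → Bool}
    (h : ∀ e, redE st ω e ↔ redE st' ω' e) : RAdjF Z₁ R st ω = RAdjF Z₁ R st' ω' := by
  funext x y
  exact propext (exists_congr fun e => and_congr_right fun _ => or_congr_left (h e))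

/-- The forced red adjacency is symmetric. -/
theorem RAdjF_symm (R : E₁ → Prop) (st : E₁ → EStat) (ω : E₁ → Bool) (x y : V₁) (h : RAdjF Z₁ R st ω x y) :
    RAdjF Z₁ R st ω y x := by
  obtain ⟨e, he, hr⟩ := h
  exact ⟨e, Joins_symm Z₁ he, hr⟩

open Classical in
/-- The red pattern with forced-red edges. -/
noncomputable def rsigF (R : E₁ → Prop) (st : E₁ → EStat) (ω : E₁ → Bool) : P3 :=
  (decide (RdF Z₁ R st ω a₁ u), decide (RdF Z₁ R st ω a₁ u'), decide (RdF Z₁ R st ω u u'))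

/-- The forced red pattern is a partition. -/
theorem trans3_rsigF (R : E₁ → Prop) (st : E₁ → EStat) (ω : E₁ → Bool) : Trans3 (rsigF Z₁ u u' a₁ R st ω) := by
  simp only [Trans3, rsigF, decide_eq_true_eq, RdF]
  refine ⟨fun h1 h2 => ?_, fun h1 h2 => ?_, fun h1 h2 => ?_⟩
  · exact reach_trans_of_symm (RAdjF_symm Z₁ R st ω) h1 h2
  · exact reach_trans' h1 h2
  · exact reach_trans' h1 (reach_trans_of_symm (RAdjF_symm Z₁ R st ω) h2 (mem_reach_self _ _))

/-- Equal forced red adjacencies give equal red patterns. -/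
theorem rsigF_congr (R : E₁ → Prop) {st st' : E₁ → EStat} {ω ω' : E₁ → Bool}
    (h : RAdjF Z₁ R st ω = RAdjF Z₁ R st' ω') : rsigF Z₁ u u' a₁ R st ω = rsigF Z₁ u u' a₁ R st' ω' := by
  simp only [rsigF, RdF, Prod.mk.injEq, decide_eq_decide, h, iff_self, and_self]

variable [DecidableEq E₁]

/-- Colouring a free edge red: the forced red pattern is that of the contraction. -/
theorem rsigF_of_true (R : E₁ → Prop) {st : E₁ → EStat} {f : E₁} (hf : st f = .free) {ω : E₁ → Bool}
    (hω : ω f = true) : rsigF Z₁ u u' a₁ R st ω = rsigF Z₁ u u' a₁ R (Function.update st f .double) ω := by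
  refine rsigF_congr Z₁ u u' a₁ R (RAdjF_congr Z₁ R fun e => ?_)
  by_cases he : e = f
  · subst he; simp [redE, hf, hω]
  · simp [redE, Function.update_of_ne he]

/-- Colouring a free edge blue: the forced red pattern is that of the deletion. -/
theorem rsigF_of_false (R : E₁ → Prop) {st : E₁ → EStat} {f : E₁} (hf : st f = .free) {ω : E₁ → Bool}
    (hω : ω f = false) : rsigF Z₁ u u' a₁ R st ω = rsigF Z₁ u u' a₁ R (Function.update st f .absent) ω := by
  refine rsigF_congr Z₁ u u' a₁ R (RAdjF_congr Z₁ R fun e => ?_)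
  by_cases he : e = f
  · subst he; simp [redE, hf, hω]
  · simp [redE, Function.update_of_ne he]

/-- A non-free edge ignores its colour (forced red pattern). -/
theorem rsigF_update_nonfree (R : E₁ → Prop) (st : E₁ → EStat) (f : E₁) {s : EStat} (hs : s ≠ .free)
    (ω : E₁ → Bool) (b : Bool) :
    rsigF Z₁ u u' a₁ R (Function.update st f s) (Function.update ω f b) =
      rsigF Z₁ u u' a₁ R (Function.update st f s) ω := by
  refine rsigF_congr Z₁ u u' a₁ R (RAdjF_congr Z₁ R fun e => ?_)
  by_cases he : e = f
  · subst he; simp [redE, hs]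
  · simp [redE, Function.update_of_ne he]

/-- Contracting an edge only coarsens the forced red pattern of its deletion. -/
theorem le3_rsigF (R : E₁ → Prop) (st : E₁ → EStat) (f : E₁) (ω : E₁ → Bool) :
    Le3 (rsigF Z₁ u u' a₁ R (Function.update st f .absent) ω)
      (rsigF Z₁ u u' a₁ R (Function.update st f .double) ω) := by
  have h : ∀ x y, RAdjF Z₁ R (Function.update st f .absent) ω x y →
      RAdjF Z₁ R (Function.update st f .double) ω x y := by
    intro x y ⟨e, he, hr⟩
    refine ⟨e, he, ?_⟩
    by_cases hef : e = f
    · subst hef; simp [redE]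
    · simpa [redE, Function.update_of_ne hef] using hr
  simp only [Le3, rsigF, RdF, decide_eq_true_eq]
  exact ⟨reach_mono h, reach_mono h, reach_mono h⟩

/-! ## The recursion with forced-red edges -/

/-- The pointwise gap of the recursion with forced-red edges. -/
noncomputable def gapFr (R : E₁ → Prop) (st : E₁ → EStat) (f : E₁) (ω : E₁ → Bool) : ℤ :=
  Fsym (rsigF Z₁ u u' a₁ R (Function.update st f .double) ω) (bsig Z₁ u u' a₁ (Function.update st f .absent) ω)
    + Fsym (rsigF Z₁ u u' a₁ R (Function.update st f .absent) ω) (bsig Z₁ u u' a₁ (Function.update st f .double) ω)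
    - Fsym (rsigF Z₁ u u' a₁ R (Function.update st f .absent) ω) (bsig Z₁ u u' a₁ (Function.update st f .absent) ω)
    - Fsym (rsigF Z₁ u u' a₁ R (Function.update st f .double) ω) (bsig Z₁ u u' a₁ (Function.update st f .double) ω)

/-- The gap is non-negative (THE KEY LEMMA). -/
theorem gapFr_nonneg (R : E₁ → Prop) (st : E₁ → EStat) (f : E₁) (ω : E₁ → Bool) :
    0 ≤ gapFr Z₁ u u' a₁ R st f ω := by
  have := key_lemma _ _ _ _ ⟨trans3_rsigF Z₁ u u' a₁ R (Function.update st f .absent) ω,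
    trans3_rsigF Z₁ u u' a₁ R (Function.update st f .double) ω,
    trans3_bsig Z₁ u u' a₁ (Function.update st f .absent) ω,
    trans3_bsig Z₁ u u' a₁ (Function.update st f .double) ω,
    le3_rsigF Z₁ u u' a₁ R st f ω, le3_bsig Z₁ u u' a₁ st f ω⟩
  unfold gapFr
  linarith

/-- Colouring `f` red or blue: the two summands of the recursion. -/
theorem summandFr_add_flip (R : E₁ → Prop) (st : E₁ → EStat) (f : E₁) (hf : st f = .free) (ω : E₁ → Bool) :
    Fsym (rsigF Z₁ u u' a₁ R st ω) (bsig Z₁ u u' a₁ st ω)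
        + Fsym (rsigF Z₁ u u' a₁ R st (flipC f ω)) (bsig Z₁ u u' a₁ st (flipC f ω)) =
      Fsym (rsigF Z₁ u u' a₁ R (Function.update st f .double) ω) (bsig Z₁ u u' a₁ (Function.update st f .absent) ω)
        + Fsym (rsigF Z₁ u u' a₁ R (Function.update st f .absent) ω)
          (bsig Z₁ u u' a₁ (Function.update st f .double) ω) := by
  have hd : EStat.double ≠ EStat.free := by decide
  have ha : EStat.absent ≠ EStat.free := by decide
  by_cases hω : ω f = true
  · have hω' : flipC f ω f = false := by simp [flipC_apply_self, hω]
    rw [rsigF_of_true Z₁ u u' a₁ R hf hω, bsig_of_true Z₁ u u' a₁ hf hω, rsigF_of_false Z₁ u u' a₁ R hf hω',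
      bsig_of_false Z₁ u u' a₁ hf hω']
    unfold flipC
    rw [rsigF_update_nonfree Z₁ u u' a₁ R st f ha, bsig_update_nonfree Z₁ u u' a₁ st f hd]
  · have hω0 : ω f = false := by simpa using hω
    have hω' : flipC f ω f = true := by simp [flipC_apply_self, hω0]
    rw [rsigF_of_false Z₁ u u' a₁ R hf hω0, bsig_of_false Z₁ u u' a₁ hf hω0, rsigF_of_true Z₁ u u' a₁ R hf hω',
      bsig_of_true Z₁ u u' a₁ hf hω']
    unfold flipC
    rw [rsigF_update_nonfree Z₁ u u' a₁ R st f hd, bsig_update_nonfree Z₁ u u' a₁ st f ha]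
    exact add_comm _ _

variable [Fintype E₁]

open Classical in
/-- The symmetrised excess with forced-red edges. -/
noncomputable def esymF (R : E₁ → Prop) (st : E₁ → EStat) : ℤ :=
  ∑ ω : E₁ → Bool, Fsym (rsigF Z₁ u u' a₁ R st ω) (bsig Z₁ u u' a₁ st ω)

/-- **THE RECURSION** with forced-red edges. -/
theorem esymF_rec (R : E₁ → Prop) (st : E₁ → EStat) (f : E₁) (hf : st f = .free) :
    2 * esymF Z₁ u u' a₁ R st = esymF Z₁ u u' a₁ R (Function.update st f .absent)
      + esymF Z₁ u u' a₁ R (Function.update st f .double) + ∑ ω : E₁ → Bool, gapFr Z₁ u u' a₁ R st f ω := by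
  have hflip : ∑ ω : E₁ → Bool, Fsym (rsigF Z₁ u u' a₁ R st ω) (bsig Z₁ u u' a₁ st ω) =
      ∑ ω : E₁ → Bool, Fsym (rsigF Z₁ u u' a₁ R st (flipC f ω)) (bsig Z₁ u u' a₁ st (flipC f ω)) :=
    (Equiv.sum_comp (flipPerm f) (fun ω => Fsym (rsigF Z₁ u u' a₁ R st ω) (bsig Z₁ u u' a₁ st ω))).symm
  have h2 : 2 * esymF Z₁ u u' a₁ R st = ∑ ω : E₁ → Bool,
      (Fsym (rsigF Z₁ u u' a₁ R st ω) (bsig Z₁ u u' a₁ st ω)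
        + Fsym (rsigF Z₁ u u' a₁ R st (flipC f ω)) (bsig Z₁ u u' a₁ st (flipC f ω))) := by
    rw [Finset.sum_add_distrib, ← hflip, esymF]; ring
  rw [h2, esymF, esymF, ← Finset.sum_add_distrib, ← Finset.sum_add_distrib]
  refine Finset.sum_congr rfl fun ω _ => ?_
  rw [summandFr_add_flip Z₁ u u' a₁ R st f hf ω]
  unfold gapFr
  ring

/-! ## The base case: the blue pattern refines the red one -/

/-- `Fsym` is non-negative on comparable pairs (it is negative only on the crossed two-block pairs). -/
theorem Fsym_nonneg_of_le3 : ∀ s t : P3, Trans3 s ∧ Trans3 t ∧ Le3 t s → 0 ≤ Fsym s t := by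
  decide

omit [DecidableEq E₁] [Fintype E₁] in
/-- Without free edges the blue pattern refines the forced red pattern. -/
theorem le3_bsig_rsigF_of_nofree (R : E₁ → Prop) (st : E₁ → EStat) (hst : ∀ e, st e ≠ .free) (ω : E₁ → Bool) :
    Le3 (bsig Z₁ u u' a₁ st ω) (rsigF Z₁ u u' a₁ R st ω) := by
  have h : ∀ x y, BAdjS Z₁ st ω x y → RAdjF Z₁ R st ω x y := by
    intro x y ⟨e, he, hb⟩
    refine ⟨e, he, Or.inl ?_⟩
    rcases hb with hb | hb
    · exact Or.inl hb
    · exact absurd hb.1 (hst e)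
  simp only [Le3, bsig, rsigF, MgS, RdF, decide_eq_true_eq]
  exact ⟨reach_mono h, reach_mono h, reach_mono h⟩

/-- Without free edges the forced symmetrised excess is non-negative. -/
theorem esymF_nonneg_of_nofree (R : E₁ → Prop) (st : E₁ → EStat) (hst : ∀ e, st e ≠ .free) :
    0 ≤ esymF Z₁ u u' a₁ R st := by
  unfold esymF
  refine Finset.sum_nonneg fun ω _ => Fsym_nonneg_of_le3 _ _ ⟨trans3_rsigF Z₁ u u' a₁ R st ω,
    trans3_bsig Z₁ u u' a₁ st ω, le3_bsig_rsigF_of_nofree Z₁ u u' a₁ R st hst ω⟩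

/-- **THE SYMMETRISED EXCESS WITH FORCED-RED EDGES IS NON-NEGATIVE** for every status. -/
theorem esymF_nonneg (R : E₁ → Prop) (st : E₁ → EStat) : 0 ≤ esymF Z₁ u u' a₁ R st := by
  suffices h : ∀ n : ℕ, ∀ st : E₁ → EStat, nfree st = n → 0 ≤ esymF Z₁ u u' a₁ R st from h _ st rfl
  intro n
  induction n with
  | zero =>
    intro st hst
    have hno : ∀ e, st e ≠ .free := by
      intro e he
      have : e ∈ (univ.filter fun e => st e = .free) := by simp [he]
      rw [Finset.card_eq_zero.mp hst] at this
      simp at this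
    exact esymF_nonneg_of_nofree Z₁ u u' a₁ R st hno
  | succ n ih =>
    intro st hst
    have hne : (univ.filter fun e => st e = .free).Nonempty := by
      rw [← Finset.card_pos]; unfold nfree at hst; omega
    obtain ⟨f, hf⟩ := hne
    have hf' : st f = .free := (Finset.mem_filter.mp hf).2
    have ha := ih (Function.update st f .absent) (by
      have := nfree_update hf' (s := .absent) (by decide); omega)
    have hd := ih (Function.update st f .double) (by
      have := nfree_update hf' (s := .double) (by decide); omega)
    have hg : 0 ≤ ∑ ω : E₁ → Bool, gapFr Z₁ u u' a₁ R st f ω :=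
      Finset.sum_nonneg fun ω _ => gapFr_nonneg Z₁ u u' a₁ R st f ω
    have := esymF_rec Z₁ u u' a₁ R st f hf'
    linarith

/-- The status of a host with the edges of `R` forced red and the others free. -/
noncomputable def forcedStatus (R : E₁ → Prop) [DecidablePred R] : E₁ → EStat :=
  fun e => if R e then EStat.absent else EStat.free

open Classical in
/-- **THEOREM (FORCED RED)**: for the host with the edges of `R` forced red and the others free, the symmetric excess
`Σ_ω Fsym (π_R ω) (π_B ω)` is non-negative (the colour of a forced edge is ignored). -/
theorem esym_forced_nonneg (R : E₁ → Prop) :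
    0 ≤ ∑ ω : E₁ → Bool, Fsym (rsigF Z₁ u u' a₁ R (forcedStatus R) ω) (bsig Z₁ u u' a₁ (forcedStatus R) ω) :=
  esymF_nonneg Z₁ u u' a₁ R (forcedStatus R)

end MultiExit

end ZoneZ

end PercRepro
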